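import Literature.NumberTheory.ModularForms.ModularCurveCuspCharts
import Literature.Geometry.Manifold.QuotientManifold
import HarnessLib

/-!
# `X(Γ)` is a compact Riemann surface: the complex structure (Shimura §1.5 Thm. 1.28; Diamond–Shurman §2.4)

Layer `Literature/NumberTheory/ModularForms`, namespace `Literature.NumberTheory.ModularForms.ModularCurve`;
sequel of `ModularCurveCuspCharts` (`X(Γ) = Cpt Γ`, compact Hausdorff connected, the cusp charts
`cuspChart i : {cuspPt i} ∪ π(σ_i{Im > 1}) ≃ {|q| < e^{−2π}}`). For a finite-index `Γ ≤ SL₂(ℤ)` acting FREELY on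
`ℍ` (no elliptic elements and `−1 ∉ Γ`; e.g. `Γ(N)`, `N ≥ 3`) the open curve `Y(Γ) = Γ∖ℍ` is a Riemann surface with
Mathlib's quotient charts (`MulAction.instChartedSpaceQuotient`; a complex manifold by the tree's
`Literature.Geometry.Manifold.QuotientManifold.isManifold`), and `X(Γ)` becomes a COMPACT RIEMANN SURFACE with the
atlas «quotient charts at old points, cusp charts at the cusps» (Shimura, Thm. 1.28 and its proof; Diamond–Shurman
§2.4: «the transition maps are holomorphic»). This is the input format of the tree's Riemann-surface library
(`[ChartedSpace ℂ M] [IsManifold 𝓘(ℂ) ω M] [CompactSpace M] [T2Space M] [ConnectedSpace M]`).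

* §1 `Y(Γ)`: `isManifold_quot`, `contMDiff_proj`, and the descent lemma `mdifferentiableOn_of_comp_proj`
  (a function on `Y(Γ)` is holomorphic where its pull-back to `ℍ` is);
* §2 the cusp coordinate is holomorphic on the sector (`mdifferentiableOn_cuspCoordQ`: it pulls back to
  `z ↦ e^{2πi σ_i⁻¹ γ⁻¹ z}`), and the inverse coordinate `q ↦ π(σ_i · log q/2πi)` is holomorphic on the punctured
  disc (`mdifferentiableAt_sectionInv`: local logarithms);
* §3 the atlas `instChartedSpace` (`liftChart y`, `cuspChart i`), `chartAt_inl`, `chartAt_cuspPt`;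
* §4 the four kinds of transition maps are holomorphic and ★ `instIsManifold : IsManifold 𝓘(ℂ) ω (Cpt Γ)`;
  `mdifferentiable_inl` (`Y(Γ) ↪ X(Γ)` is holomorphic), `mdifferentiable_inl_comp_proj`.

Everything is proved; definitions: `inlChart`, `liftChart`, the `ChartedSpace` instance; one further instance
(`IsManifold`) on the new type.

## References

* G. Shimura, *Introduction to the arithmetic theory of automorphic functions* (1971), §1.5 Thm. 1.28 (proof:
  the complex structure on `Γ∖ℍ*`). [ShimuraIATAF1971]
* F. Diamond, J. Shurman, *A first course in modular forms*, GTM 228 (2005), §2.4 (pp. 58–62). [DiamondShurman2005]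
-/

noncomputable section

open scoped MatrixGroups Pointwise Topology Real Manifold ContDiff
open Set Filter Function UpperHalfPlane Complex
open Literature.Topology.CoveringSpaces Literature.Geometry.Manifold

namespace Literature.NumberTheory.ModularForms

namespace ModularCurve

variable (Γ : Subgroup SL(2, ℤ)) [Γ.FiniteIndex] [IsCancelSMul (Γ : Subgroup (GL (Fin 2) ℝ)) ℍ]

/-! ### §1 The Riemann surface `Y(Γ)` and descent of holomorphy along `π` -/

omit [Γ.FiniteIndex] [IsCancelSMul (Γ : Subgroup (GL (Fin 2) ℝ)) ℍ] in
/-- Elements of `Γ` act holomorphically on `ℍ` (Mathlib `UpperHalfPlane.contMDiff_smul`, `det = 1`).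
[cite: ShimuraIATAF1971, §1.5] -/
theorem contMDiff_smul_of_mem (γ : (Γ : Subgroup (GL (Fin 2) ℝ))) : ContMDiff 𝓘(ℂ) 𝓘(ℂ) ω (fun τ : ℍ => γ • τ) := by
  have hdet : 0 < (γ : GL (Fin 2) ℝ).det.val := by
    rw [Subgroup.HasDetOne.det_eq γ.2, Units.val_one]; exact one_pos
  exact UpperHalfPlane.contMDiff_smul hdet

/-- **`Y(Γ)` is a Riemann surface** for `Γ` acting freely (tree `QuotientManifold.isManifold`; proper discontinuity
from arithmeticity).
[cite: ShimuraIATAF1971, §1.5 Thm. 1.28] -/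
theorem isManifold_quot : IsManifold 𝓘(ℂ) ω (Quot Γ) := QuotientManifold.isManifold (contMDiff_smul_of_mem Γ)

/-- **The projection `π : ℍ → Y(Γ)` is holomorphic.** [cite: ShimuraIATAF1971, §1.5] -/
theorem contMDiff_proj : haveI := isManifold_quot Γ; ContMDiff 𝓘(ℂ) 𝓘(ℂ) ω (proj Γ) :=
  QuotientManifold.contMDiff_mk (contMDiff_smul_of_mem Γ)

/-- **Descent of holomorphy along `π`.** If `U ⊆ Y(Γ)` is open and `f ∘ π` is holomorphic on `π⁻¹U`, then `f` is
holomorphic on `U` (locally `f = (f ∘ π) ∘ s` for a holomorphic local section `s` of `π`).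
[cite: ShimuraIATAF1971, §1.5 Thm. 1.28 (proof)] -/
theorem mdifferentiableOn_of_comp_proj {f : Quot Γ → ℂ} {U : Set (Quot Γ)} (hU : IsOpen U)
    (hf : MDifferentiableOn 𝓘(ℂ) 𝓘(ℂ) (f ∘ proj Γ) (proj Γ ⁻¹' U)) :
    haveI := isManifold_quot Γ; MDifferentiableOn 𝓘(ℂ) 𝓘(ℂ) f U := by
  haveI := isManifold_quot Γ
  intro y hy
  obtain ⟨p, rfl⟩ := proj_surjective Γ y
  set hloc := QuotientManifold.isLocalHomeomorph_mk (G := (Γ : Subgroup (GL (Fin 2) ℝ))) (M := ℍ)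
  set s := hloc.localInverseAt p with hs
  have hsrc : proj Γ p ∈ s.source := hloc.apply_self_mem_localInverseAt_source
  -- `f = (f ∘ π) ∘ s` on `s.source`
  have heq : ∀ y ∈ s.source, f y = (f ∘ proj Γ) (s y) := fun y hy' => by
    change f y = f (QuotientManifold.mk (s y))
    rw [QuotientManifold.mk_localInverseAt hy']
  have hs_diff : MDifferentiableAt 𝓘(ℂ) 𝓘(ℂ) s (proj Γ p) :=
    ((QuotientManifold.contMDiffOn_localInverseAt (contMDiff_smul_of_mem Γ) p).contMDiffAt
      (s.open_source.mem_nhds hsrc)).mdifferentiableAt (by simp)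
  have hsp : s (proj Γ p) ∈ proj Γ ⁻¹' U := by
    change proj Γ (s (proj Γ p)) ∈ U
    rw [show proj Γ (s (proj Γ p)) = proj Γ p from QuotientManifold.mk_localInverseAt hsrc]; exact hy
  have hfp : MDifferentiableAt 𝓘(ℂ) 𝓘(ℂ) (f ∘ proj Γ) (s (proj Γ p)) :=
    (hf _ hsp).mdifferentiableAt ((hU.preimage (continuous_proj Γ)).mem_nhds hsp)
  have hcomp : MDifferentiableAt 𝓘(ℂ) 𝓘(ℂ) ((f ∘ proj Γ) ∘ s) (proj Γ p) := hfp.comp _ hs_diff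
  exact (hcomp.congr_of_eventuallyEq (Filter.eventually_of_mem (s.open_source.mem_nhds hsrc) heq)).mdifferentiableWithinAt

/-! ### §2 The cusp coordinate and its inverse are holomorphic -/

/-- **The cusp coordinate is holomorphic on the sector**: its pull-back to `γσ_i{Im > 1}` is
`z ↦ e^{2πi σ_i⁻¹γ⁻¹z}`. [cite: ShimuraIATAF1971, §1.5 Thm. 1.28 (proof)] [cite: DiamondShurman2005, §2.4] -/
theorem mdifferentiableOn_cuspCoordQ (i : Fin (numCusps Γ)) :
    haveI := isManifold_quot Γ; MDifferentiableOn 𝓘(ℂ) 𝓘(ℂ) (cuspCoordQ Γ i) (sector Γ i) := by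
  refine mdifferentiableOn_of_comp_proj Γ (isOpen_sector Γ i) fun z hz => ?_
  -- `z = γ⁻¹ σ_i w` with `Im w > 1`
  obtain ⟨w, hw, hwz⟩ := (mem_proj_image_iff Γ).1 hz
  obtain ⟨γ, hγ, e⟩ := (proj_eq_iff Γ).1 hwz
  -- on the open set `γ⁻¹σ_i{Im > 1} ∋ z` the pull-back is `e^{2πi σ_i⁻¹ γ z'}`
  have hopen : IsOpen ((γ⁻¹ * frameGL Γ i) • {w : ℍ | 1 < w.im}) :=
    (isOpen_lt continuous_const UpperHalfPlane.continuous_im).smul _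
  have hmem : z ∈ (γ⁻¹ * frameGL Γ i) • {w : ℍ | 1 < w.im} :=
    ⟨w, hw, by show (γ⁻¹ * frameGL Γ i) • w = z; rw [mul_smul, ← e, inv_smul_smul]⟩
  have hev : (cuspCoordQ Γ i ∘ proj Γ) =ᶠ[𝓝 z]
      fun z' => Function.Periodic.qParam 1 ((((frameGL Γ i)⁻¹ * γ) • z' : ℍ) : ℂ) := by
    filter_upwards [hopen.mem_nhds hmem] with z' hz'
    obtain ⟨w', hw', rfl⟩ := hz'
    simp only [comp_apply]
    rw [mul_smul, proj_smul Γ (Subgroup.inv_mem _ hγ), cuspCoordQ_proj Γ i hw', mul_smul, smul_inv_smul, inv_smul_smul]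
  refine (MDifferentiableAt.congr_of_eventuallyEq ?_ hev).mdifferentiableWithinAt
  have hdet : 0 < ((frameGL Γ i)⁻¹ * γ : GL (Fin 2) ℝ).det.val := by
    rw [map_mul, map_inv, Subgroup.HasDetOne.det_eq hγ, mul_one, Units.val_inv_eq_inv_val]
    simp [frameGL]
  exact ((Function.Periodic.differentiable_qParam (h := (1 : ℝ))).mdifferentiable.comp
    (UpperHalfPlane.mdifferentiable_coe.comp (UpperHalfPlane.mdifferentiable_smul hdet))) z

/-- **The frame section `q ↦ π(σ_i · invQ q)` is holomorphic at every `q₀` with `0 < |q₀| < 1`** (near `q₀` it is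
`π ∘ (σ_i ·) ∘ ofComplex ∘ L` with the holomorphic local logarithm `L(q) = invQ q₀ + log(q/q₀)/2πi`).
[cite: ShimuraIATAF1971, §1.5 Thm. 1.28 (proof)] [cite: DiamondShurman2005, §2.4] -/
theorem mdifferentiableAt_sectionInv (i : Fin (numCusps Γ)) {q₀ : ℂ} (hq₀ : q₀ ≠ 0) (hq₀1 : ‖q₀‖ < 1) :
    haveI := isManifold_quot Γ;
    MDifferentiableAt 𝓘(ℂ) 𝓘(ℂ) (fun q : ℂ => proj Γ (frameGL Γ i • invQ q)) q₀ := by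
  haveI := isManifold_quot Γ
  set L : ℂ → ℂ := fun q => Function.Periodic.invQParam 1 q₀ + Function.Periodic.invQParam 1 (q / q₀) with hL
  have hLq : ∀ q, q ≠ 0 → Function.Periodic.qParam 1 (L q) = q := by
    intro q hq
    simp only [hL, Function.Periodic.qParam, div_one, ofReal_one]
    rw [mul_add, Complex.exp_add]
    have e1 := Function.Periodic.qParam_right_inv (h := (1 : ℝ)) one_ne_zero hq₀
    have e2 := Function.Periodic.qParam_right_inv (h := (1 : ℝ)) one_ne_zero (div_ne_zero hq hq₀)
    simp only [Function.Periodic.qParam, div_one, ofReal_one] at e1 e2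
    rw [e1, e2, mul_div_cancel₀ _ hq₀]
  have hLdiff : DifferentiableAt ℂ L q₀ := by
    refine (differentiableAt_const _).add ?_
    simp only [Function.Periodic.invQParam]
    refine (differentiableAt_const _).mul ?_
    have hg : DifferentiableAt ℂ Complex.log (q₀ / q₀) := by
      rw [div_self hq₀]; exact Complex.differentiableAt_log Complex.one_mem_slitPlane
    exact hg.comp q₀ (f := fun q => q / q₀) ((differentiableAt_id).div_const q₀)
  have hL₀ : L q₀ = Function.Periodic.invQParam 1 q₀ := by
    simp [hL, div_self hq₀, Function.Periodic.invQParam, Complex.log_one]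
  have himL₀ : 0 < (L q₀).im := by
    rw [hL₀]; exact lt_im_invQParam_one hq₀ (T := 0) (by simpa using hq₀1)
  have hev_im : ∀ᶠ q in 𝓝 q₀, 0 < (L q).im :=
    (Complex.continuous_im.continuousAt.comp hLdiff.continuousAt).eventually (lt_mem_nhds himL₀)
  have hev_ne : ∀ᶠ q in 𝓝 q₀, q ≠ 0 := isOpen_ne.mem_nhds hq₀
  have hev_lt : ∀ᶠ q in 𝓝 q₀, ‖q‖ < 1 := (continuous_norm.continuousAt (x := q₀)).eventually (gt_mem_nhds hq₀1)
  have hev : (fun q : ℂ => proj Γ (frameGL Γ i • invQ q)) =ᶠ[𝓝 q₀]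
      fun q => proj Γ (frameGL Γ i • UpperHalfPlane.ofComplex (L q)) := by
    filter_upwards [hev_im, hev_ne, hev_lt] with q hq hq0 hq1
    refine proj_frameGL_smul_eq_of_qParam_eq Γ i ?_
    rw [qParam_invQ hq0 hq1, UpperHalfPlane.ofComplex_apply_of_im_pos hq, UpperHalfPlane.coe_mk, hLq q hq0]
  refine MDifferentiableAt.congr_of_eventuallyEq ?_ hev
  have h1 : MDifferentiableAt 𝓘(ℂ) 𝓘(ℂ) UpperHalfPlane.ofComplex (L q₀) := UpperHalfPlane.mdifferentiableAt_ofComplex himL₀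
  have h2 : MDifferentiableAt 𝓘(ℂ) 𝓘(ℂ) (fun τ : ℍ => proj Γ (frameGL Γ i • τ)) (UpperHalfPlane.ofComplex (L q₀)) := by
    have hdet : 0 < (frameGL Γ i).det.val := by simp [frameGL]
    exact (((contMDiff_proj Γ).mdifferentiable (by simp)).comp (UpperHalfPlane.mdifferentiable_smul hdet)) _
  have h3 : MDifferentiableAt 𝓘(ℂ) 𝓘(ℂ) ((fun τ : ℍ => proj Γ (frameGL Γ i • τ)) ∘ (UpperHalfPlane.ofComplex ∘ L)) q₀ :=
    h2.comp q₀ (h1.comp q₀ hLdiff.mdifferentiableAt)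
  exact h3

/-! ### §3 The atlas of `X(Γ)` -/

/-- `inl` as an open partial homeomorphism `Y(Γ) ≃ range inl`. [cite: ShimuraIATAF1971, §1.5] -/
def inlChart : OpenPartialHomeomorph (Quot Γ) (Cpt Γ) := (isOpenEmbedding_inl Γ).toOpenPartialHomeomorph (inl Γ)

omit [IsCancelSMul (Γ : Subgroup (GL (Fin 2) ℝ)) ℍ] in
/-- `inlChart` is `inl`. [cite: ShimuraIATAF1971, §1.5] -/
@[simp] theorem inlChart_apply : ⇑(inlChart Γ) = inl Γ := (isOpenEmbedding_inl Γ).toOpenPartialHomeomorph_apply _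

omit [IsCancelSMul (Γ : Subgroup (GL (Fin 2) ℝ)) ℍ] in
/-- The source of `inlChart` is everything. [cite: ShimuraIATAF1971, §1.5] -/
@[simp] theorem inlChart_source : (inlChart Γ).source = univ := (isOpenEmbedding_inl Γ).toOpenPartialHomeomorph_source _

omit [IsCancelSMul (Γ : Subgroup (GL (Fin 2) ℝ)) ℍ] in
/-- The target of `inlChart` is the range of `inl`. [cite: ShimuraIATAF1971, §1.5] -/
@[simp] theorem inlChart_target : (inlChart Γ).target = range (inl Γ) := (isOpenEmbedding_inl Γ).toOpenPartialHomeomorph_target _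

omit [IsCancelSMul (Γ : Subgroup (GL (Fin 2) ℝ)) ℍ] in
/-- `inlChart.symm ∘ inl = id`. [cite: ShimuraIATAF1971, §1.5] -/
@[simp] theorem inlChart_symm_inl (y : Quot Γ) : (inlChart Γ).symm (inl Γ y) = y :=
  (isOpenEmbedding_inl Γ).toOpenPartialHomeomorph_left_inv

/-- **The chart of `X(Γ)` at an old point**: the quotient chart of `Y(Γ)` transported along `inl`.
[cite: ShimuraIATAF1971, §1.5 Thm. 1.28 (proof)] -/
def liftChart (y : Quot Γ) : OpenPartialHomeomorph (Cpt Γ) ℂ := (inlChart Γ).symm.trans (chartAt ℂ y)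

/-- The lifted chart at an old point. [cite: ShimuraIATAF1971, §1.5] -/
@[simp] theorem liftChart_inl (y y' : Quot Γ) : liftChart Γ y (inl Γ y') = chartAt ℂ y y' := by
  change chartAt ℂ y ((inlChart Γ).symm (inl Γ y')) = _
  rw [inlChart_symm_inl]

/-- The inverse of the lifted chart. [cite: ShimuraIATAF1971, §1.5] -/
@[simp] theorem liftChart_symm_apply (y : Quot Γ) (z : ℂ) : (liftChart Γ y).symm z = inl Γ ((chartAt ℂ y).symm z) := by
  change (inlChart Γ).symm.symm ((chartAt ℂ y).symm z) = _
  rw [OpenPartialHomeomorph.symm_symm, inlChart_apply]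

/-- The source of the lifted chart. [cite: ShimuraIATAF1971, §1.5] -/
theorem liftChart_source (y : Quot Γ) : (liftChart Γ y).source = inl Γ '' (chartAt ℂ y).source := by
  rw [liftChart, OpenPartialHomeomorph.trans_source, OpenPartialHomeomorph.symm_source, inlChart_target]
  ext x
  constructor
  · rintro ⟨⟨s, rfl⟩, hx⟩
    rw [mem_preimage, inlChart_symm_inl] at hx
    exact ⟨s, hx, rfl⟩
  · rintro ⟨s, hs, rfl⟩
    exact ⟨⟨s, rfl⟩, by rw [mem_preimage, inlChart_symm_inl]; exact hs⟩

/-- Membership of an old point in the source of a lifted chart. [cite: ShimuraIATAF1971, §1.5] -/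
@[simp] theorem inl_mem_liftChart_source {y y' : Quot Γ} : inl Γ y' ∈ (liftChart Γ y).source ↔ y' ∈ (chartAt ℂ y).source := by
  rw [liftChart_source, (inl_injective Γ).mem_set_image]

/-- The source of a lifted chart lies in the range of `inl`. [cite: ShimuraIATAF1971, §1.5] -/
theorem liftChart_source_subset (y : Quot Γ) : (liftChart Γ y).source ⊆ range (inl Γ) := by
  rw [liftChart_source]; rintro _ ⟨s, -, rfl⟩; exact ⟨s, rfl⟩

/-- The target of the lifted chart. [cite: ShimuraIATAF1971, §1.5] -/
@[simp] theorem liftChart_target (y : Quot Γ) : (liftChart Γ y).target = (chartAt ℂ y).target := by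
  rw [liftChart, OpenPartialHomeomorph.trans_target, OpenPartialHomeomorph.symm_target, inlChart_source, preimage_univ,
    inter_univ]

/-- **THE ATLAS OF `X(Γ)`**: quotient charts at the old points, cusp charts at the cusps.
[cite: ShimuraIATAF1971, §1.5 Thm. 1.28] [cite: DiamondShurman2005, §2.4] -/
instance instChartedSpace : ChartedSpace ℂ (Cpt Γ) where
  atlas := range (liftChart Γ) ∪ range (cuspChart Γ)
  chartAt := Sum.elim (fun y => liftChart Γ y) fun i => cuspChart Γ i
  mem_chart_source x := by
    rcases inl_or_cuspPt Γ x with ⟨y, rfl⟩ | ⟨i, rfl⟩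
    · change inl Γ y ∈ (liftChart Γ y).source
      rw [inl_mem_liftChart_source]
      exact mem_chart_source ℂ y
    · exact cuspPt_mem_cuspChart_source Γ i
  chart_mem_atlas x := by
    rcases inl_or_cuspPt Γ x with ⟨y, rfl⟩ | ⟨i, rfl⟩
    · exact Or.inl ⟨y, rfl⟩
    · exact Or.inr ⟨i, rfl⟩

/-- The chart at an old point. [cite: ShimuraIATAF1971, §1.5] -/
@[simp] theorem chartAt_inl (y : Quot Γ) : chartAt ℂ (inl Γ y) = liftChart Γ y := rfl

/-- The chart at a cusp. [cite: ShimuraIATAF1971, §1.5] -/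
@[simp] theorem chartAt_cuspPt (i : Fin (numCusps Γ)) : chartAt ℂ (cuspPt Γ i) = cuspChart Γ i := rfl

/-! ### §4 The transition maps are holomorphic; `X(Γ)` is a complex manifold -/

/-- **Old–old transitions** (`chart y' ∘ (chart y)⁻¹`, holomorphic on `Y(Γ)`). [cite: ShimuraIATAF1971, §1.5 Thm. 1.28 (proof)] -/
theorem differentiableOn_liftChart_liftChart (y y' : Quot Γ) :
    DifferentiableOn ℂ ((liftChart Γ y).symm.trans (liftChart Γ y')) ((liftChart Γ y).symm.trans (liftChart Γ y')).source := by
  haveI := isManifold_quot Γ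
  have hsrc : ((liftChart Γ y).symm.trans (liftChart Γ y')).source = ((chartAt ℂ y).symm.trans (chartAt ℂ y')).source := by
    ext z
    simp only [OpenPartialHomeomorph.trans_source, OpenPartialHomeomorph.symm_source, liftChart_target, mem_inter_iff,
      mem_preimage, liftChart_symm_apply, inl_mem_liftChart_source]
  have hT : MDifferentiableOn 𝓘(ℂ) 𝓘(ℂ) ((chartAt ℂ y).symm.trans (chartAt ℂ y')) ((chartAt ℂ y).symm.trans (chartAt ℂ y')).source := by
    intro z hz
    rw [OpenPartialHomeomorph.trans_source, OpenPartialHomeomorph.symm_source] at hz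
    exact ((mdifferentiableAt_atlas (I := 𝓘(ℂ)) (chart_mem_atlas ℂ y') hz.2).comp z
      (mdifferentiableAt_atlas_symm (I := 𝓘(ℂ)) (chart_mem_atlas ℂ y) hz.1)).mdifferentiableWithinAt
  rw [hsrc]
  refine (mdifferentiableOn_iff_differentiableOn.1 hT).congr fun z _ => ?_
  change liftChart Γ y' ((liftChart Γ y).symm z) = chartAt ℂ y' ((chartAt ℂ y).symm z)
  rw [liftChart_symm_apply, liftChart_inl]

/-- **Old–cusp transitions** (`cuspCoord_i ∘ (chart y)⁻¹`, holomorphic by `mdifferentiableOn_cuspCoordQ`).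
[cite: ShimuraIATAF1971, §1.5 Thm. 1.28 (proof)] -/
theorem differentiableOn_liftChart_cuspChart (y : Quot Γ) (i : Fin (numCusps Γ)) :
    DifferentiableOn ℂ ((liftChart Γ y).symm.trans (cuspChart Γ i)) ((liftChart Γ y).symm.trans (cuspChart Γ i)).source := by
  haveI := isManifold_quot Γ
  have hsrc : ∀ z ∈ ((liftChart Γ y).symm.trans (cuspChart Γ i)).source,
      z ∈ (chartAt ℂ y).target ∧ (chartAt ℂ y).symm z ∈ sector Γ i := fun z hz => by
    simp only [OpenPartialHomeomorph.trans_source, OpenPartialHomeomorph.symm_source, liftChart_target, mem_inter_iff,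
      mem_preimage, liftChart_symm_apply, cuspChart_source, inl_mem_cuspNhd_iff] at hz
    obtain ⟨hz1, w, hw, hwz⟩ := hz
    exact ⟨hz1, hwz ▸ ⟨_, ⟨w, hw, rfl⟩, rfl⟩⟩
  have hM : MDifferentiableOn 𝓘(ℂ) 𝓘(ℂ) (fun z => cuspCoordQ Γ i ((chartAt ℂ y).symm z))
      ((liftChart Γ y).symm.trans (cuspChart Γ i)).source := fun z hz =>
    ((((mdifferentiableOn_cuspCoordQ Γ i) _ (hsrc z hz).2).mdifferentiableAt ((isOpen_sector Γ i).mem_nhds (hsrc z hz).2)).comp z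
      (mdifferentiableAt_atlas_symm (I := 𝓘(ℂ)) (chart_mem_atlas ℂ y) (hsrc z hz).1)).mdifferentiableWithinAt
  refine (mdifferentiableOn_iff_differentiableOn.1 hM).congr fun z _ => ?_
  change cuspChart Γ i ((liftChart Γ y).symm z) = cuspCoordQ Γ i ((chartAt ℂ y).symm z)
  rw [liftChart_symm_apply, coe_cuspChart, cuspCoord_inl]

/-- **Cusp–old transitions** (`chart y ∘ π(σ_i · invQ ·)`, holomorphic by `mdifferentiableAt_sectionInv`).
[cite: ShimuraIATAF1971, §1.5 Thm. 1.28 (proof)] -/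
theorem differentiableOn_cuspChart_liftChart (i : Fin (numCusps Γ)) (y : Quot Γ) :
    DifferentiableOn ℂ ((cuspChart Γ i).symm.trans (liftChart Γ y)) ((cuspChart Γ i).symm.trans (liftChart Γ y)).source := by
  haveI := isManifold_quot Γ
  have hsrc : ∀ q ∈ ((cuspChart Γ i).symm.trans (liftChart Γ y)).source,
      q ≠ 0 ∧ ‖q‖ < 1 ∧ proj Γ (frameGL Γ i • invQ q) ∈ (chartAt ℂ y).source := fun q hq => by
    simp only [OpenPartialHomeomorph.trans_source, OpenPartialHomeomorph.symm_source, cuspChart_target, mem_inter_iff,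
      Metric.mem_ball, dist_zero_right, mem_preimage, coe_cuspChart_symm] at hq
    have hq0 : q ≠ 0 := by
      rintro rfl
      have h0 := liftChart_source_subset Γ y hq.2
      rw [cuspCoordInv_zero] at h0
      obtain ⟨s, hs⟩ := h0
      exact inl_ne_cuspPt Γ s i hs
    refine ⟨hq0, hq.1.trans_le (by rw [Real.exp_le_one_iff]; nlinarith [Real.pi_pos]), ?_⟩
    have h2 := hq.2
    rwa [cuspCoordInv_of_ne_zero Γ i hq0, inl_mem_liftChart_source] at h2
  have hM : MDifferentiableOn 𝓘(ℂ) 𝓘(ℂ) (fun q => chartAt ℂ y (proj Γ (frameGL Γ i • invQ q)))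
      ((cuspChart Γ i).symm.trans (liftChart Γ y)).source := fun q hq => by
    obtain ⟨hq0, hq1, hsrc'⟩ := hsrc q hq
    exact ((mdifferentiableAt_atlas (I := 𝓘(ℂ)) (chart_mem_atlas ℂ y) hsrc').comp q
      (mdifferentiableAt_sectionInv Γ i hq0 hq1)).mdifferentiableWithinAt
  refine (mdifferentiableOn_iff_differentiableOn.1 hM).congr fun q hq => ?_
  obtain ⟨hq0, -, -⟩ := hsrc q hq
  change liftChart Γ y ((cuspChart Γ i).symm q) = chartAt ℂ y (proj Γ (frameGL Γ i • invQ q))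
  rw [coe_cuspChart_symm, cuspCoordInv_of_ne_zero Γ i hq0, liftChart_inl]

omit [IsCancelSMul (Γ : Subgroup (GL (Fin 2) ℝ)) ℍ] in
/-- **Cusp–cusp transitions**: identity (same cusp) or empty (distinct cusps: disjoint sources).
[cite: ShimuraIATAF1971, §1.5 Thm. 1.28 (proof)] -/
theorem differentiableOn_cuspChart_cuspChart (i j : Fin (numCusps Γ)) :
    DifferentiableOn ℂ ((cuspChart Γ i).symm.trans (cuspChart Γ j)) ((cuspChart Γ i).symm.trans (cuspChart Γ j)).source := by
  by_cases hij : i = j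
  · subst hij
    refine differentiableOn_id.congr fun z hz => ?_
    rw [OpenPartialHomeomorph.trans_source, OpenPartialHomeomorph.symm_source] at hz
    exact (cuspChart Γ i).right_inv hz.1
  · have hempty : ((cuspChart Γ i).symm.trans (cuspChart Γ j)).source = ∅ := by
      refine eq_empty_of_forall_notMem fun z hz => ?_
      rw [OpenPartialHomeomorph.trans_source, OpenPartialHomeomorph.symm_source] at hz
      have h1 : (cuspChart Γ i).symm z ∈ (cuspChart Γ i).source := (cuspChart Γ i).map_target hz.1
      have h2 : (cuspChart Γ i).symm z ∈ (cuspChart Γ j).source := hz.2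
      rw [cuspChart_source] at h1 h2
      exact disjoint_left.1 (disjoint_cuspNhd Γ hij le_rfl le_rfl) h1 h2
    rw [hempty]
    exact differentiableOn_empty

/-- ★ **`X(Γ)` IS A COMPACT RIEMANN SURFACE**: a complex manifold (with `instCompactSpace`, `instT2Space`,
`instConnectedSpace` of the previous files). [cite: ShimuraIATAF1971, §1.5 Thm. 1.28] [cite: DiamondShurman2005, §2.4] -/
instance instIsManifold : IsManifold 𝓘(ℂ) ω (Cpt Γ) := by
  refine isManifold_of_contDiffOn _ _ _ ?_
  rintro e e' (⟨y, rfl⟩ | ⟨i, rfl⟩) (⟨y', rfl⟩ | ⟨i', rfl⟩) <;>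
    simp only [modelWithCornersSelf_coe, modelWithCornersSelf_coe_symm, range_id, inter_univ, preimage_id_eq, id_eq,
      CompTriple.comp_eq]
  · exact (differentiableOn_liftChart_liftChart Γ y y').contDiffOn ((liftChart Γ y).symm.trans (liftChart Γ y')).open_source
  · exact (differentiableOn_liftChart_cuspChart Γ y i').contDiffOn ((liftChart Γ y).symm.trans (cuspChart Γ i')).open_source
  · exact (differentiableOn_cuspChart_liftChart Γ i y').contDiffOn ((cuspChart Γ i).symm.trans (liftChart Γ y')).open_source
  · exact (differentiableOn_cuspChart_cuspChart Γ i i').contDiffOn ((cuspChart Γ i).symm.trans (cuspChart Γ i')).open_source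

/-- **`inl : Y(Γ) → X(Γ)` is holomorphic.** [cite: ShimuraIATAF1971, §1.5] -/
theorem mdifferentiable_inl : haveI := isManifold_quot Γ; MDifferentiable 𝓘(ℂ) 𝓘(ℂ) (inl Γ) := by
  haveI := isManifold_quot Γ
  intro y
  rw [mdifferentiableAt_iff_of_mem_source (mem_chart_source ℂ y) (by
    rw [chartAt_inl, inl_mem_liftChart_source]; exact mem_chart_source ℂ y)]
  refine ⟨(continuous_inl Γ).continuousAt, ?_⟩
  have hev : (extChartAt 𝓘(ℂ) (inl Γ y) ∘ inl Γ ∘ (extChartAt 𝓘(ℂ) y).symm) =ᶠ[𝓝[range (𝓘(ℂ, ℂ))] (extChartAt 𝓘(ℂ) y y)] id := by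
    rw [modelWithCornersSelf_coe, range_id, nhdsWithin_univ]
    have hopen : IsOpen (chartAt ℂ y).target := (chartAt ℂ y).open_target
    filter_upwards [hopen.mem_nhds (by simp)] with z hz
    simp only [comp_apply, extChartAt, OpenPartialHomeomorph.extend_coe, OpenPartialHomeomorph.extend_coe_symm,
      modelWithCornersSelf_coe, modelWithCornersSelf_coe_symm, id_eq, CompTriple.comp_eq, chartAt_inl, liftChart_inl]
    exact (chartAt ℂ y).right_inv hz
  exact differentiableWithinAt_id.congr_of_eventuallyEq hev (by simp)

/-- **`inl ∘ π : ℍ → X(Γ)` is holomorphic.** [cite: ShimuraIATAF1971, §1.5] -/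
theorem mdifferentiable_inl_comp_proj : MDifferentiable 𝓘(ℂ) 𝓘(ℂ) (inl Γ ∘ proj Γ) := by
  haveI := isManifold_quot Γ
  exact (mdifferentiable_inl Γ).comp ((contMDiff_proj Γ).mdifferentiable (by simp))

end ModularCurve

end Literature.NumberTheory.ModularForms

end
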